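import Mathlib
import Literature.Analysis.Convex.Subgradient
import Literature.Analysis.Convex.LinesearchPDHG
import HarnessLib

/-!
# Inexact first-order primal–dual algorithms (Rasch–Chambolle 2020): `ε`-subgradients, inexact
proximal points of type 0–3, and the `O(1/N)` ergodic rate of PDHG with inexact proxima

Topic `Literature/Analysis/Convex` (companion of `PrimalDualHybridGradient.lean` — exact PDHG with
fixed steps —, of `RelaxedPDHG.lean` §6 — inexact steps with SUMMABLE absolute errors, convergence
of the iterates but no rate [EB92, Thm 3] — and of `LinesearchPDHG.lean`, whose saddle-function
vocabulary `lagr`, `IsSaddleOn`, `IsProxPt`, `pgap`, `dgap` is reused). Namespaces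
`Literature.Analysis.Convex` (the `ε`-subgradient, next to `HasSubgradientWithinAt`) and
`Literature.Analysis.Convex.InexactPDHG`. Everything PROVED; no named facts (D-0026).

Source. J. Rasch, A. Chambolle, *Inexact first-order primal–dual algorithms*, Comput. Optim.
Appl. 76 (2020) 381–430, doi:10.1007/s10589-020-00186-y = arXiv:1803.10576 [RaschChambolle2020]
(held: `paper:arxiv-1803.10576`; typed from the arXiv LaTeX source: §2 "Inexact computations of the
proximal point", §3 and §3.1 "The convex case: no acceleration", Appendix 6.1 "Two technical
lemmas"; the numbering Def 2.1–2.5 / Lemma 2.3 / Lemma 2.6 / Prop 2.7 / Lemma 3.1 / Thm 3.2 /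
Cor 3.4 / Lemma 6.1 and the equation numbers (2.x), (3.x) are those of that source).

THE PRINTED STATEMENTS. §2: for `g` proper convex l.s.c. on a Hilbert space, `τ > 0`, `y` given,
`prox_{τg}(y) = argmin_x ‖x − y‖²/2τ + g(x)` (2.1), proximity function `G_τ(x) = ‖x − y‖²/2τ + g(x)`
(2.2), `ε`-subdifferential `∂_ε g(z) = {p : g(x) ≥ g(z) + ⟨p, x − z⟩ − ε ∀x}`,
`0 ∈ ∂_ε g(z) ⟺ g(z) ≤ inf g + ε` (2.3). **Def 2.1** (type 0) `‖z − prox_{τg}(y)‖ ≤ √(2τε)`;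
**Def 2.2** (type 1) `0 ∈ ∂_ε G_τ(z)`; **Lemma 2.3** type 1 ⇒ `z ∈ dom g` and type 0;
**Def 2.4** (type 2) `(y − z)/τ ∈ ∂_ε g(z)`; **Def 2.5** (type 3) `z = prox_{τg}(y + e)` for some
`‖e‖ ≤ √(2τε)`; "type-2 and type-3 proxima are also proxima of type 1"; **Lemma 2.6** type 1 ⇒
`∃ r, ‖r‖ ≤ √(2τε), (y − z − r)/τ ∈ ∂_ε g(z)`; **Prop 2.7** a duality-gap test for type 2.
§3: `min_x max_y ⟨Kx, y⟩ + f(x) + g(x) − h*(y)` (3.1), `L = ‖K‖`, a saddle point exists; the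
inexact step (3.5): `y̌ ≈₂^δ prox_{σh*}(ȳ + σKx̃)`, `x̌ ≈ᵢ^ε prox_{τg}(x̄ − τ(K*ỹ + ∇f(x̄) + e))`.
**Lemma 3.1**: for `i = 1` and all `(x, y)`,
`L(x̌,y) − L(x,y̌) ≤ ‖x−x̄‖²/2τ + ‖y−ȳ‖²/2σ − ‖x−x̌‖²/2τ − (1−τL_f)‖x̄−x̌‖²/2τ − ‖y−y̌‖²/2σ − ‖ȳ−y̌‖²/2σ
 + ⟨K(x−x̌), ỹ−y̌⟩ − ⟨K(x̃−x̌), y−y̌⟩ + (‖e‖ + √(2ε/τ))‖x−x̌‖ + ε + δ` (type 2: no square root;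
type 3: no final `ε`). Algorithm (3.10): `y^{n+1} ≈₂^{δ_{n+1}} prox_{σh*}(y^n + σK(2x^n − x^{n−1}))`,
`x^{n+1} ≈ᵢ^{ε_{n+1}} prox_{τg}(x^n − τ(K*y^{n+1} + ∇f(x^n) + e^{n+1}))`. **Theorem 3.2**: for
`τL_f + στL² + τβL < 1` (small `β > 0`), `N ≥ 1`, `X^N = (Σ_{n=1}^N x^n)/N`, `Y^N = (Σ_{n=1}^N y^n)/N`
and a saddle point `(x̂, ŷ)`:
`L(X^N, ŷ) − L(x̂, Y^N) ≤ (‖x̂ − x^0‖ + √(τ/σ)‖ŷ − y^0‖ + 2A_{N,i} + √(2B_{N,i}))² / (2τN)`,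
`A_{N,1} = Σ_{n=1}^N (τ‖e^n‖ + √(2τε_n))`, `B_{N,1} = Σ τε_n + τδ_n`, `A_{N,2} = Σ τ‖e^n‖`,
`B_{N,2} = B_{N,1}`, `A_{N,3} = A_{N,1}`, `B_{N,3} = Σ τδ_n`. **Cor 3.4** (`α > 1/2`): summable
errors ⇒ `O(1/N)`. **Lemma 6.1** [Schmidt–Le Roux–Bach 2011]: `u ≥ 0`,
`u_N² ≤ S_N + Σ_{n=1}^N λ_n u_n`, `S` increasing, `S_0 ≥ u_0²`, `λ ≥ 0` ⇒
`u_N ≤ ½Σλ_n + (S_N + (½Σλ_n)²)^{1/2}`.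

WHAT IS TYPED HERE (real-valued `g`, `h*` with their effective domains carried as sets `C`, `D`,
as in `LinesearchPDHG.lean`; the smooth term `f` of the paper is `0`).
* `HasEpsSubgradientWithinAt f s ε p x` — the `ε`-subgradient relative to a set (`ε = 0`:
  `HasSubgradientWithinAt`), (2.3) `hasEpsSubgradientWithinAt_zero_left_iff`.
* `proxObj` (2.2); `IsType0ProxPt` / `IsType1ProxPt` / `IsType2ProxPt` / `IsType3ProxPt`
  (Defs 2.1, 2.2, 2.4, 2.5; type 2 is written multiplied by `τ`, `isType2ProxPt_iff` is the
  `ε`-subgradient form, `isType2ProxPt_zero_iff` the exact case); the common form `IsApproxProxPt`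
  of Lemma 2.6 (`∃ r, ‖r‖ ≤ ρ, (u − z − r)/τ ∈ ∂_ε g(z)`), with `IsType2ProxPt.isApproxProxPt`
  (`ρ = 0`), `IsType3ProxPt.isApproxProxPt` (`ρ = √(2τε)`, `ε`-part `0`);
  `IsType2ProxPt.isType1ProxPt`, `IsType3ProxPt.isType1ProxPt`, `IsApproxProxPt.isType1ProxPt`
  (with `ε + ρ²/2τ`); **Lemma 2.3** `IsType1ProxPt.isType0ProxPt` (via `proxObj_sub_proxObj_ge`,
  the quadratic growth of `G_τ` at the exact proximal point); `isType2ProxPt_linear_cone_iff` —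
  Def 2.4 unfolded for the conic kernel `g = ⟨c,·⟩ + ι_C`, `C` a cone: a type-2 approximate
  projection is `z ∈ C`, `u − τc − z ∈ C°` and complementarity gap `−⟨u − τc − z, z⟩ ≤ τε`.
* **Lemma 6.1** `le_sbound_of_sq_le` (`lamSum`, `sbound`, `le_half_add_sqrt_of_sq_le`).
* **Lemma 3.1** `general_inequality` (for `f = 0`, primal step in the common form with radius `ρ`:
  error term `(‖e‖ + ρ/τ)‖x − x̌‖ + ε + δ`; `ρ = √(2τε)` gives the printed `√(2ε/τ)`).
* Algorithm (3.10) as a run `IsInexactPDHGRun K g hs C D τ σ x y e ρ ε δ` (`xprev`: `x^{−1} = x^0`;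
  `of_type2`), error sums `errA` (`A_N = Σ(τ‖e^n‖ + ρ_n)`), `errB` (`B_N = Στ(ε_n + δ_n)`), ergodic
  averages `erg`; on a run: `step_le` (3.12), `sum_gap_le_aux`, **`sum_gap_add_le`** (3.13),
  `gap_nonneg`, `norm_sub_sq_le_rec`, **`norm_sub_le`** (3.14: the iterates stay within
  `boundM = 2A_N + ‖x̂ − x^0‖ + √(τ/σ)‖ŷ − y^0‖ + √(2B_N)` of `x̂`), `init_add_sum_err_le` (3.15),
  `sum_gap_le`, **`ergodic_gap_le` = Theorem 3.2**, `ergodic_gap_le_of_bounded` (Cor 3.4, `α > 1/2`),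
  `ergodic_conicL_gap_le` (Theorem 3.2 for the conic kernel `g = ⟪c,·⟫ + ι_C`, `h* = ⟪b,·⟫ + ι_D`
  of `PrimalDualHybridGradient.lean`: inexact projections).

Reading for the certified-SDP first-order kernels (why this file exists). Inexact proximal steps —
projections onto cones computed by approximate or reduced-precision eigensolvers, inner iterative
solves stopped early — enter PDHG as type-0/2 errors; the theorem says the `O(1/N)` ergodic rate of
[CP11/CP16] survives with the SAME constant shape as long as the error sums `A_N`, `B_N` stay bounded
(summable `τ‖e^n‖`, `ρ_n = √(2τε_n)`, `ε_n`, `δ_n`), and degrades otherwise: a constant per-step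
precision `ε` makes `A_N` grow like `N√(2τε)` and the bound like `N ε` — no guarantee below the
error floor (Cor 3.4: `ε_n = O(n^{−2α})`, `α ≤ 1/2`, gives `O(ln²N/N)`, `O(N^{−2α})`). A type-2 step
is certifiable a posteriori (Prop 2.7; for cones `isType2ProxPt_linear_cone_iff`).

Deviations, flagged at the declarations: (a) `f = 0` (`L_f = 0`; the descent-lemma term of (3.8)
is not carried — TODO(general form)); (b) `β = 0` and `τσ‖K‖² ≤ 1` in place of the strict
condition with a small `β > 0`, which the paper needs only for the convergence of the iterates
(Thm 3.5, not typed) — the ergodic bound is proved under the weaker hypothesis; (c) the primal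
step is recorded in the common form of Lemma 2.6 with a free radius `ρ_n`, so one proof gives all
three cases (`A_N = Σ(τ‖e^n‖ + ρ_n)`); Lemma 2.6 itself (type 1 ⇒ common form, via the
`ε`-subdifferential sum rule (2.5)) and Prop 2.7 (Fenchel–Rockafellar duality) are NOT typed, so
for type-1 primal steps the run hypothesis is the conclusion of the printed Lemma 2.6; (d) `u_0`
enters Lemma 6.1 through the instance `N = 0` of the recursion (`u_0² ≤ S_0`).

Deliberately NOT here: §3.2–§3.3 (accelerated and linearly convergent versions under strong
convexity, Thms 3.6–3.17), Thm 3.5 (convergence of the iterates), Appendix 6.2 (type-0 errors),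
the cases `α ≤ 1/2` of Cor 3.4 (Lemma 6.2), §4–§5 (numerics); infinite sums / `tsum` versions.
-/

namespace Literature.Analysis.Convex

open scoped RealInnerProductSpace
open Finset

/-! ### `ε`-subgradients -/

section EpsSubgradient

variable {E : Type*} [NormedAddCommGroup E] [InnerProductSpace ℝ E]

/-- `p` is an **`ε`-subgradient** of `f` at `x` relative to `s`:
`f y ≥ f x + ⟪p, y − x⟫ − ε` for all `y ∈ s` (the `ε`-subdifferential `∂_ε f(x)` is the set of such
`p`; `ε = 0` is `HasSubgradientWithinAt`). [cite: RaschChambolle2020, §2 (ε-subdifferential, before (2.3))] -/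
def HasEpsSubgradientWithinAt (f : E → ℝ) (s : Set E) (ε : ℝ) (p x : E) : Prop :=
  ∀ y ∈ s, f x + ⟪p, y - x⟫ - ε ≤ f y

variable {f : E → ℝ} {s : Set E} {ε ε' : ℝ} {p x : E}

/-- Unfolding lemma. [cite: RaschChambolle2020, §2 (ε-subdifferential)] -/
theorem hasEpsSubgradientWithinAt_iff :
    HasEpsSubgradientWithinAt f s ε p x ↔ ∀ y ∈ s, f x + ⟪p, y - x⟫ - ε ≤ f y := Iff.rfl

/-- `∂_0 f = ∂f`. [cite: RaschChambolle2020, §2 (ε-subdifferential)] -/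
theorem hasEpsSubgradientWithinAt_zero_iff :
    HasEpsSubgradientWithinAt f s 0 p x ↔ HasSubgradientWithinAt f s p x := by
  simp [HasEpsSubgradientWithinAt, HasSubgradientWithinAt]

/-- `∂f ⊆ ∂_ε f` for `ε ≥ 0`. [cite: RaschChambolle2020, §2 (ε-subdifferential)] -/
theorem HasSubgradientWithinAt.hasEpsSubgradientWithinAt (h : HasSubgradientWithinAt f s p x)
    (hε : 0 ≤ ε) : HasEpsSubgradientWithinAt f s ε p x :=
  fun y hy => by linarith [h y hy]

/-- `∂_ε f ⊆ ∂_{ε'} f` for `ε ≤ ε'`. [cite: RaschChambolle2020, §2 (ε-subdifferential)] -/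
theorem HasEpsSubgradientWithinAt.mono_eps (h : HasEpsSubgradientWithinAt f s ε p x) (hle : ε ≤ ε') :
    HasEpsSubgradientWithinAt f s ε' p x :=
  fun y hy => by linarith [h y hy]

/-- Restricting the set keeps `ε`-subgradients. [cite: RaschChambolle2020, §2 (ε-subdifferential)] -/
theorem HasEpsSubgradientWithinAt.mono {t : Set E} (h : HasEpsSubgradientWithinAt f s ε p x)
    (hts : t ⊆ s) : HasEpsSubgradientWithinAt f t ε p x :=
  fun y hy => h y (hts hy)

/-- **(2.3)**: `0 ∈ ∂_ε f(x) ↔ f(x) ≤ inf_s f + ε` (`ε`-optimality).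
[cite: RaschChambolle2020, §2 (2.3)] -/
theorem hasEpsSubgradientWithinAt_zero_left_iff :
    HasEpsSubgradientWithinAt f s ε 0 x ↔ ∀ y ∈ s, f x ≤ f y + ε := by
  simp only [HasEpsSubgradientWithinAt, inner_zero_left, add_zero]
  exact forall₂_congr fun y _ => by constructor <;> intro h <;> linarith

end EpsSubgradient

/-! ### Inexact proximal points of type 0, 1, 2, 3 (Definitions 2.1–2.5) -/

namespace InexactPDHG

variable {X Y : Type*} [NormedAddCommGroup X] [InnerProductSpace ℝ X]
  [NormedAddCommGroup Y] [InnerProductSpace ℝ Y]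

open LinesearchPDHG (lagr IsSaddleOn IsProxPt two_inner_sub_sub)

/-- The proximity function `G_τ(z) = ‖z − u‖²/(2τ) + g(z)` of the point `u` (2.2).
[cite: RaschChambolle2020, §2 (2.2)] -/
noncomputable def proxObj (g : X → ℝ) (τ : ℝ) (u z : X) : ℝ := ‖z - u‖ ^ 2 / (2 * τ) + g z

/-- **Definition 2.1 (type-0 approximation)** relative to an exact proximal point `p` of `u`:
`‖z − p‖ ≤ √(2τε)` (it need not be feasible). [cite: RaschChambolle2020, Def 2.1] -/
def IsType0ProxPt (τ ε : ℝ) (p z : X) : Prop := ‖z - p‖ ≤ Real.sqrt (2 * τ * ε)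

/-- **Definition 2.2 (type-1 approximation)**: `0 ∈ ∂_ε G_τ(z)`, i.e. (by (2.3)) `z` minimises the
proximity function of `u` over `C = dom g` up to `ε`: `z ∈ C` and `G_τ(z) ≤ G_τ(x) + ε` for all
`x ∈ C`. [cite: RaschChambolle2020, Def 2.2] -/
def IsType1ProxPt (C : Set X) (g : X → ℝ) (τ ε : ℝ) (u z : X) : Prop :=
  z ∈ C ∧ ∀ x ∈ C, proxObj g τ u z ≤ proxObj g τ u x + ε

/-- **Definition 2.4 (type-2 approximation)**: `(u − z)/τ ∈ ∂_ε g(z)` (relative to `C = dom g`),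
written multiplied by `τ > 0`: `z ∈ C` and `τ (g z − g x) ≤ ⟪z − u, x − z⟫ + τ ε` for all `x ∈ C`
(`isType2ProxPt_iff` is the `ε`-subgradient form). [cite: RaschChambolle2020, Def 2.4] -/
def IsType2ProxPt (C : Set X) (g : X → ℝ) (τ ε : ℝ) (u z : X) : Prop :=
  z ∈ C ∧ ∀ x ∈ C, τ * (g z - g x) ≤ ⟪z - u, x - z⟫ + τ * ε

/-- **Definition 2.5 (type-3 approximation)**: `z = prox_{τ g}(u + e)` exactly, for some input error
`‖e‖ ≤ √(2τε)` ("a correct output for an incorrect input"). [cite: RaschChambolle2020, Def 2.5] -/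
def IsType3ProxPt (C : Set X) (g : X → ℝ) (τ ε : ℝ) (u z : X) : Prop :=
  ∃ e : X, ‖e‖ ≤ Real.sqrt (2 * τ * ε) ∧ IsProxPt C g τ (u + e) z

/-- The common form of the type-1/2/3 approximations used by all proofs (**Lemma 2.6**): `z ∈ C`
and there is `r` with `‖r‖ ≤ ρ` and `(u − z − r)/τ ∈ ∂_ε g(z)`, written multiplied by `τ`:
`τ (g z − g x) ≤ ⟪z + r − u, x − z⟫ + τ ε` on `C`. Type 2 is `ρ = 0`; type 3 is `ρ = √(2τε)` with
`ε`-part `0` (`r = −e`); type 1 gives `ρ = √(2τε)` by the `ε`-subdifferential sum rule (2.5)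
[Lemma 2.6, not typed here]. [cite: RaschChambolle2020, Lemma 2.6] -/
def IsApproxProxPt (C : Set X) (g : X → ℝ) (τ ρ ε : ℝ) (u z : X) : Prop :=
  z ∈ C ∧ ∃ r : X, ‖r‖ ≤ ρ ∧ ∀ x ∈ C, τ * (g z - g x) ≤ ⟪z + r - u, x - z⟫ + τ * ε

variable {C : Set X} {g : X → ℝ} {τ ρ ε : ℝ} {u z p : X}

/-- Type 2 in `ε`-subgradient form: `(u − z)/τ ∈ ∂_ε g(z)` relative to `C` (`τ > 0`).
[cite: RaschChambolle2020, Def 2.4] -/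
theorem isType2ProxPt_iff (hτ : 0 < τ) :
    IsType2ProxPt C g τ ε u z ↔ z ∈ C ∧ HasEpsSubgradientWithinAt g C ε (τ⁻¹ • (u - z)) z := by
  refine and_congr_right fun _ => forall₂_congr fun x _ => ?_
  rw [real_inner_smul_left]
  have e1 : ⟪u - z, x - z⟫ = -⟪z - u, x - z⟫ := by
    rw [← inner_neg_left, neg_sub]
  rw [e1]
  constructor
  · intro h
    have : τ⁻¹ * ⟪z - u, x - z⟫ + ε ≥ g z - g x := by
      rw [ge_iff_le, ← mul_le_mul_iff_right₀ hτ]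
      have : τ * (τ⁻¹ * ⟪z - u, x - z⟫ + ε) = ⟪z - u, x - z⟫ + τ * ε := by field_simp
      rw [this]; linarith
    nlinarith
  · intro h
    have h' : g z - g x ≤ τ⁻¹ * ⟪z - u, x - z⟫ + ε := by nlinarith
    have := mul_le_mul_of_nonneg_left h' hτ.le
    have e2 : τ * (τ⁻¹ * ⟪z - u, x - z⟫ + ε) = ⟪z - u, x - z⟫ + τ * ε := by field_simp
    linarith [e2]

/-- The exact proximal point is the type-2 approximation with `ε = 0`.
[cite: RaschChambolle2020, §2 (2.1) with Def 2.4] -/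
theorem isType2ProxPt_zero_iff : IsType2ProxPt C g τ 0 u z ↔ IsProxPt C g τ u z := by
  simp [IsType2ProxPt, IsProxPt]

/-- **Type-2 approximate projection steps, checkable form.** For the conic kernel
`g = ⟪c, ·⟫ + ι_C` with `C` a convex cone (so that `prox_{τ g}(u) = P_C(u − τc)`), a point `z` is a
type-2 approximation of `prox_{τ g}(u)` with precision `ε` iff `z ∈ C`, the residual
`w = u − τc − z` lies in the polar cone of `C` (`⟪w, x⟫ ≤ 0` on `C`) and the complementarity gap is
at most `τε`: `−⟪w, z⟫ ≤ τε` (the exact projection is the case `⟪w, z⟫ = 0`, Moreau's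
decomposition; for a self-dual cone such as `S^n_+` this reads: `z ⪰ 0`, `z − (u − τc) ⪰ 0`,
`⟪z − (u − τc), z⟫ ≤ τε`). This is Definition 2.4 unfolded for a cone (compare Proposition 2.7,
the duality-gap test for type-2 approximations in general, not typed here).
[cite: RaschChambolle2020, Def 2.4] -/
theorem isType2ProxPt_linear_cone_iff {C : Set X} (h0 : (0 : X) ∈ C)
    (hcone : ∀ x ∈ C, ∀ t : ℝ, 0 ≤ t → t • x ∈ C) (c u z : X) (τ ε : ℝ) :
    IsType2ProxPt C (fun x => ⟪c, x⟫) τ ε u z ↔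
      z ∈ C ∧ (∀ x ∈ C, ⟪u - τ • c - z, x⟫ ≤ 0) ∧ -⟪u - τ • c - z, z⟫ ≤ τ * ε := by
  -- the defining inequality is `⟪u − τc − z, x − z⟫ ≤ τε` on `C`
  have key : ∀ x : X, (τ * (⟪c, z⟫ - ⟪c, x⟫) ≤ ⟪z - u, x - z⟫ + τ * ε ↔
      ⟪u - τ • c - z, x - z⟫ ≤ τ * ε) := fun x => by
    have e : ⟪u - τ • c - z, x - z⟫ = -⟪z - u, x - z⟫ - τ * (⟪c, x⟫ - ⟪c, z⟫) := by
      simp only [inner_sub_left, inner_sub_right, real_inner_smul_left]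
      ring
    rw [e]
    constructor <;> intro h <;> linarith
  constructor
  · rintro ⟨hz, h⟩
    have h' : ∀ x ∈ C, ⟪u - τ • c - z, x - z⟫ ≤ τ * ε := fun x hx => (key x).1 (h x hx)
    have hz0 : -⟪u - τ • c - z, z⟫ ≤ τ * ε := by
      have := h' 0 h0
      rwa [zero_sub, inner_neg_right] at this
    refine ⟨hz, fun x hx => ?_, hz0⟩
    -- scaling `x ↦ t x`, `t → ∞`
    by_contra hpos
    replace hpos : 0 < ⟪u - τ • c - z, x⟫ := not_le.1 hpos
    set M := τ * ε + ⟪u - τ • c - z, z⟫ with hM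
    have hM0 : 0 ≤ M := by linarith
    have ht : ∀ t : ℝ, 0 ≤ t → t * ⟪u - τ • c - z, x⟫ ≤ M := fun t ht => by
      have := h' (t • x) (hcone x hx t ht)
      rw [inner_sub_right, real_inner_smul_right] at this
      linarith
    have := ht ((M + 1) / ⟪u - τ • c - z, x⟫) (by positivity)
    rw [div_mul_cancel₀ _ hpos.ne'] at this
    linarith
  · rintro ⟨hz, hpol, hgap⟩
    refine ⟨hz, fun x hx => (key x).2 ?_⟩
    rw [inner_sub_right]
    linarith [hpol x hx]

/-- Type 1 is `0 ∈ ∂_ε G_τ(z)` ((2.3) applied to the proximity function).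
[cite: RaschChambolle2020, Def 2.2 with (2.3)] -/
theorem isType1ProxPt_iff :
    IsType1ProxPt C g τ ε u z ↔ z ∈ C ∧ HasEpsSubgradientWithinAt (proxObj g τ u) C ε 0 z := by
  rw [hasEpsSubgradientWithinAt_zero_left_iff]
  rfl

/-- The three-point identity behind all comparisons of proximity values:
`G_τ(z) − G_τ(x) = g z − g x + (⟪z − u, x − z⟫... )`; precisely
`‖x − u‖² = ‖x − z‖² + ‖z − u‖² + 2⟪x − z, z − u⟫`. [cite: RaschChambolle2020, §2 (proof of Lemma 2.3)] -/
theorem norm_sub_sq_eq_three (x z u : X) :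
    ‖x - u‖ ^ 2 = ‖x - z‖ ^ 2 + ‖z - u‖ ^ 2 + 2 * ⟪x - z, z - u⟫ := by
  have h : x - u = (x - z) + (z - u) := by abel
  rw [h, norm_add_sq_real]
  ring

/-- Type 2 ⇒ the common form with `ρ = 0`. [cite: RaschChambolle2020, Lemma 2.6 (remark after)] -/
theorem IsType2ProxPt.isApproxProxPt (h : IsType2ProxPt C g τ ε u z) :
    IsApproxProxPt C g τ 0 ε u z :=
  ⟨h.1, 0, by simp, fun x hx => by simpa using h.2 x hx⟩

/-- Type 3 ⇒ the common form with `ρ = √(2τε)` and `ε`-part `0` (`r = −e`).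
[cite: RaschChambolle2020, Lemma 2.6 (remark after)] -/
theorem IsType3ProxPt.isApproxProxPt (h : IsType3ProxPt C g τ ε u z) :
    IsApproxProxPt C g τ (Real.sqrt (2 * τ * ε)) 0 u z := by
  obtain ⟨e, he, hz, hineq⟩ := h
  refine ⟨hz, -e, by simpa using he, fun x hx => ?_⟩
  have h1 := hineq x hx
  have e1 : z + -e - u = z - (u + e) := by abel
  rw [e1, mul_zero, add_zero]
  exact h1

/-- The common form is monotone in its tolerances. [cite: RaschChambolle2020, Lemma 2.6] -/
theorem IsApproxProxPt.mono (h : IsApproxProxPt C g τ ρ ε u z) {ρ' ε' : ℝ} (hρ : ρ ≤ ρ')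
    (hε : ε ≤ ε') (hτ : 0 ≤ τ) : IsApproxProxPt C g τ ρ' ε' u z := by
  obtain ⟨hz, r, hr, hineq⟩ := h
  refine ⟨hz, r, hr.trans hρ, fun x hx => (hineq x hx).trans ?_⟩
  have := mul_le_mul_of_nonneg_left hε hτ
  linarith

/-- **Type 2 ⇒ type 1** (type 2 is the extreme case `ε₂ = 0` of the decomposition (2.5)).
[cite: RaschChambolle2020, §2 (after (2.5))] -/
theorem IsType2ProxPt.isType1ProxPt (h : IsType2ProxPt C g τ ε u z) (hτ : 0 < τ) :
    IsType1ProxPt C g τ ε u z := by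
  refine ⟨h.1, fun x hx => ?_⟩
  have h1 := h.2 x hx
  have h3 := norm_sub_sq_eq_three x z u
  unfold proxObj
  have hτ2 : 0 < 2 * τ := by linarith
  -- `G(z) − G(x) = g z − g x + (‖z−u‖² − ‖x−u‖²)/(2τ) ≤ (⟪z−u,x−z⟫ + τε)/τ − (‖x−z‖² + 2⟪x−z,z−u⟫)/(2τ)`
  have key : τ * (g z - g x) + (‖z - u‖ ^ 2 - ‖x - u‖ ^ 2) / 2 ≤ τ * ε := by
    rw [h3]
    have : ⟪z - u, x - z⟫ = ⟪x - z, z - u⟫ := real_inner_comm _ _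
    nlinarith [norm_nonneg (x - z), this]
  have : (g z - g x) + (‖z - u‖ ^ 2 - ‖x - u‖ ^ 2) / (2 * τ) ≤ ε := by
    have e : (g z - g x) + (‖z - u‖ ^ 2 - ‖x - u‖ ^ 2) / (2 * τ) =
        (τ * (g z - g x) + (‖z - u‖ ^ 2 - ‖x - u‖ ^ 2) / 2) / τ := by
      field_simp
    rw [e, div_le_iff₀ hτ]
    linarith
  have e2 : ‖z - u‖ ^ 2 / (2 * τ) + g z - (‖x - u‖ ^ 2 / (2 * τ) + g x) =
      (g z - g x) + (‖z - u‖ ^ 2 - ‖x - u‖ ^ 2) / (2 * τ) := by ring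
  linarith [e2]

/-- **The common form ⇒ type 1** with tolerance `ε + ρ²/(2τ)`: in particular **type 3 ⇒ type 1**
with the same `ε` ("being the two extreme cases, type-2 and type-3 proxima are also proxima of
type 1"). [cite: RaschChambolle2020, §2 (after Def 2.5)] -/
theorem IsApproxProxPt.isType1ProxPt (h : IsApproxProxPt C g τ ρ ε u z) (hτ : 0 < τ) :
    IsType1ProxPt C g τ (ε + ρ ^ 2 / (2 * τ)) u z := by
  obtain ⟨hz, r, hr, hineq⟩ := h
  refine ⟨hz, fun x hx => ?_⟩
  have h1 := hineq x hx
  have h3 := norm_sub_sq_eq_three x z u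
  unfold proxObj
  have hρ : 0 ≤ ρ := (norm_nonneg r).trans hr
  -- `⟪z + r − u, x − z⟫ = ⟪z − u, x − z⟫ + ⟪r, x − z⟫`, `⟪r, x − z⟫ ≤ ‖r‖‖x − z‖ ≤ ½‖r‖² + ½‖x−z‖²`
  have hsplit : ⟪z + r - u, x - z⟫ = ⟪x - z, z - u⟫ + ⟪r, x - z⟫ := by
    have : z + r - u = (z - u) + r := by abel
    rw [this, inner_add_left, real_inner_comm (z - u)]
  have hcs : ⟪r, x - z⟫ ≤ ‖r‖ * ‖x - z‖ := real_inner_le_norm _ _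
  have hyoung : ‖r‖ * ‖x - z‖ ≤ (‖r‖ ^ 2 + ‖x - z‖ ^ 2) / 2 := by
    nlinarith [sq_nonneg (‖r‖ - ‖x - z‖)]
  have hr2 : ‖r‖ ^ 2 ≤ ρ ^ 2 := pow_le_pow_left₀ (norm_nonneg _) hr 2
  have key : τ * (g z - g x) + (‖z - u‖ ^ 2 - ‖x - u‖ ^ 2) / 2 ≤ τ * ε + ρ ^ 2 / 2 := by
    rw [h3]; rw [hsplit] at h1
    nlinarith
  have hτ2 : 0 < 2 * τ := by linarith
  have : (g z - g x) + (‖z - u‖ ^ 2 - ‖x - u‖ ^ 2) / (2 * τ) ≤ ε + ρ ^ 2 / (2 * τ) := by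
    have e : (g z - g x) + (‖z - u‖ ^ 2 - ‖x - u‖ ^ 2) / (2 * τ) =
        (τ * (g z - g x) + (‖z - u‖ ^ 2 - ‖x - u‖ ^ 2) / 2) / τ := by
      field_simp
    have e' : ε + ρ ^ 2 / (2 * τ) = (τ * ε + ρ ^ 2 / 2) / τ := by field_simp
    rw [e, e', div_le_div_iff_of_pos_right hτ]
    exact key
  have e2 : ‖z - u‖ ^ 2 / (2 * τ) + g z - (‖x - u‖ ^ 2 / (2 * τ) + g x) =
      (g z - g x) + (‖z - u‖ ^ 2 - ‖x - u‖ ^ 2) / (2 * τ) := by ring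
  linarith [e2]

/-- **Type 3 ⇒ type 1** with the same precision. [cite: RaschChambolle2020, §2 (after Def 2.5)] -/
theorem IsType3ProxPt.isType1ProxPt (h : IsType3ProxPt C g τ ε u z) (hτ : 0 < τ) (hε : 0 ≤ ε) :
    IsType1ProxPt C g τ ε u z := by
  have h1 := h.isApproxProxPt.isType1ProxPt hτ
  have e : (0 : ℝ) + Real.sqrt (2 * τ * ε) ^ 2 / (2 * τ) = ε := by
    rw [Real.sq_sqrt (by positivity), zero_add]
    field_simp
  rwa [e] at h1

/-- The proximity function grows quadratically away from an exact proximal point: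
`G_τ(z) − G_τ(p) ≥ ‖z − p‖²/(2τ)` for `z ∈ C` (strong convexity of `G_τ`; the step in the proof of
Lemma 2.3). [cite: RaschChambolle2020, Lemma 2.3 (proof)] -/
theorem proxObj_sub_proxObj_ge (hp : IsProxPt C g τ u p) (hτ : 0 < τ) (hz : z ∈ C) :
    ‖z - p‖ ^ 2 / (2 * τ) ≤ proxObj g τ u z - proxObj g τ u p := by
  have h1 := hp.2 z hz
  have h3 := norm_sub_sq_eq_three z p u
  unfold proxObj
  have key : ‖z - p‖ ^ 2 / 2 ≤ τ * (g z - g p) + (‖z - u‖ ^ 2 - ‖p - u‖ ^ 2) / 2 := by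
    rw [h3]
    have : ⟪p - u, z - p⟫ = ⟪z - p, p - u⟫ := real_inner_comm _ _
    nlinarith [this]
  have hτ2 : 0 < 2 * τ := by linarith
  have e : ‖z - u‖ ^ 2 / (2 * τ) + g z - (‖p - u‖ ^ 2 / (2 * τ) + g p) =
      (τ * (g z - g p) + (‖z - u‖ ^ 2 - ‖p - u‖ ^ 2) / 2) / τ := by
    field_simp; ring
  have e1 : ‖z - p‖ ^ 2 / (2 * τ) = (‖z - p‖ ^ 2 / 2) / τ := by
    rw [div_div]
  rw [e, e1]
  exact div_le_div_of_nonneg_right key hτ.le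

/-- **Lemma 2.3**: a type-1 approximation is a type-0 approximation — `‖z − p‖ ≤ √(2τε)` for the
exact proximal point `p` of `u` (and `z ∈ dom g`). [cite: RaschChambolle2020, Lemma 2.3] -/
theorem IsType1ProxPt.isType0ProxPt (h : IsType1ProxPt C g τ ε u z) (hp : IsProxPt C g τ u p)
    (hτ : 0 < τ) : IsType0ProxPt τ ε p z := by
  have h1 := h.2 p hp.1
  have h2 := proxObj_sub_proxObj_ge hp hτ h.1
  unfold IsType0ProxPt
  have h3 : ‖z - p‖ ^ 2 ≤ 2 * τ * ε := by
    have h4 : ‖z - p‖ ^ 2 / (2 * τ) ≤ ε := by linarith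
    rwa [div_le_iff₀ (by linarith), mul_comm ε] at h4
  calc ‖z - p‖ = Real.sqrt (‖z - p‖ ^ 2) := (Real.sqrt_sq (norm_nonneg _)).symm
    _ ≤ Real.sqrt (2 * τ * ε) := Real.sqrt_le_sqrt h3

/-- Type 2 and type 3 approximations are type-0 approximations (via type 1 and Lemma 2.3).
[cite: RaschChambolle2020, Lemma 2.3 (with §2 after Def 2.5)] -/
theorem IsType2ProxPt.isType0ProxPt (h : IsType2ProxPt C g τ ε u z) (hp : IsProxPt C g τ u p)
    (hτ : 0 < τ) : IsType0ProxPt τ ε p z :=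
  (h.isType1ProxPt hτ).isType0ProxPt hp hτ

/-! ### A technical lemma on real sequences (Lemma 6.1, from [Schmidt–Le Roux–Bach 2011]) -/

section Schmidt

/-- `Λ_N = Σ_{n=1}^N λ_n`. [cite: RaschChambolle2020, Lemma 6.1] -/
noncomputable def lamSum (lam : ℕ → ℝ) (N : ℕ) : ℝ := ∑ n ∈ Finset.range N, lam (n + 1)

/-- The bound `½Λ_N + (S_N + (½Λ_N)²)^{1/2}` of Lemma 6.1. [cite: RaschChambolle2020, Lemma 6.1] -/
noncomputable def sbound (S lam : ℕ → ℝ) (N : ℕ) : ℝ :=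
  lamSum lam N / 2 + Real.sqrt (S N + (lamSum lam N / 2) ^ 2)

/-- `Λ_N ≥ 0` for `λ ≥ 0`. [cite: RaschChambolle2020, Lemma 6.1] -/
theorem lamSum_nonneg {lam : ℕ → ℝ} (hlam : ∀ n, 0 ≤ lam n) (N : ℕ) : 0 ≤ lamSum lam N :=
  Finset.sum_nonneg fun _ _ => hlam _

/-- `Λ` is nondecreasing for `λ ≥ 0`. [cite: RaschChambolle2020, Lemma 6.1] -/
theorem lamSum_mono {lam : ℕ → ℝ} (hlam : ∀ n, 0 ≤ lam n) : Monotone (lamSum lam) :=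
  fun _ _ h => Finset.sum_le_sum_of_subset_of_nonneg (Finset.range_mono h) fun _ _ _ => hlam _

/-- The bound of Lemma 6.1 is nondecreasing in `N`. [cite: RaschChambolle2020, Lemma 6.1] -/
theorem sbound_mono {S lam : ℕ → ℝ} (hlam : ∀ n, 0 ≤ lam n) (hS : Monotone S) :
    Monotone (sbound S lam) := by
  intro n N h
  unfold sbound
  have h1 := lamSum_mono hlam h
  have h0 := lamSum_nonneg hlam n
  have h2 : Real.sqrt (S n + (lamSum lam n / 2) ^ 2) ≤ Real.sqrt (S N + (lamSum lam N / 2) ^ 2) :=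
    Real.sqrt_le_sqrt (by nlinarith [hS h])
  linarith

/-- The quadratic step: `v² ≤ S + Λ v` implies `v ≤ ½Λ + (S + ¼Λ²)^{1/2}`.
[cite: RaschChambolle2020, Lemma 6.1 (proof)] -/
theorem le_half_add_sqrt_of_sq_le {v Λ S : ℝ} (h : v ^ 2 ≤ S + Λ * v) :
    v ≤ Λ / 2 + Real.sqrt (S + (Λ / 2) ^ 2) := by
  have h1 : (v - Λ / 2) ^ 2 ≤ S + (Λ / 2) ^ 2 := by nlinarith
  have h2 : v - Λ / 2 ≤ Real.sqrt (S + (Λ / 2) ^ 2) :=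
    calc v - Λ / 2 ≤ |v - Λ / 2| := le_abs_self _
      _ = Real.sqrt ((v - Λ / 2) ^ 2) := (Real.sqrt_sq_eq_abs _).symm
      _ ≤ Real.sqrt (S + (Λ / 2) ^ 2) := Real.sqrt_le_sqrt h1
  linarith

/-- **Lemma 6.1** [Schmidt–Le Roux–Bach 2011]: if `u ≥ 0` satisfies
`u_N² ≤ S_N + Σ_{n=1}^N λ_n u_n` for all `N ≥ 0` (at `N = 0`: `u_0² ≤ S_0`), with `S` nondecreasing and
`λ ≥ 0`, then `u_N ≤ ½Σ_{n=1}^N λ_n + (S_N + (½Σ_{n=1}^N λ_n)²)^{1/2}` for all `N`.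
[cite: RaschChambolle2020, Lemma 6.1] -/
theorem le_sbound_of_sq_le {u S lam : ℕ → ℝ} (hlam : ∀ n, 0 ≤ lam n) (hS : Monotone S)
    (hrec : ∀ N, u N ^ 2 ≤ S N + ∑ n ∈ Finset.range N, lam (n + 1) * u (n + 1)) (N : ℕ) :
    u N ≤ sbound S lam N := by
  induction N using Nat.strong_induction_on with
  | _ N ih =>
    have hprev : ∀ n < N, u n ≤ sbound S lam N :=
      fun n hn => (ih n hn).trans (sbound_mono hlam hS hn.le)
    set m := max (u N) (sbound S lam N) with hm
    have hsum : ∑ n ∈ Finset.range N, lam (n + 1) * u (n + 1) ≤ lamSum lam N * m := by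
      rw [lamSum, Finset.sum_mul]
      refine Finset.sum_le_sum fun n hn => mul_le_mul_of_nonneg_left ?_ (hlam _)
      rcases Nat.lt_or_ge (n + 1) N with h | h
      · exact (hprev _ h).trans (le_max_right _ _)
      · have hn' : n + 1 = N := le_antisymm (Finset.mem_range.1 hn) h
        rw [hn']; exact le_max_left _ _
    have h1 : u N ^ 2 ≤ S N + lamSum lam N * m := (hrec N).trans (by linarith)
    by_cases hc : u N ≤ sbound S lam N
    · exact hc
    · have hm' : m = u N := max_eq_left (not_le.1 hc).le
      rw [hm'] at h1
      exact le_half_add_sqrt_of_sq_le h1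

end Schmidt

/-! ### Lemma 3.1: the descent inequality of one inexact primal–dual step (no smooth term `f`) -/

section GeneralInequality

variable [CompleteSpace X] [CompleteSpace Y]

/-- **Lemma 3.1 (general inequality, `f = 0`)**: let `τ, σ > 0` and let `(x̌, y̌)` be obtained
from `(x̄, ȳ)` and `(x̃, ỹ)` by the inexact primal–dual step (3.5)
`y̌ ≈₂^δ prox_{σ h*}(ȳ + σ K x̃)`, `x̌ ≈^{(ρ,ε)} prox_{τ g}(x̄ − τ (K* ỹ + e))` (the common form of a
type-1/2/3 approximation, `IsApproxProxPt`; type `i = 1` has `ρ = √(2τε)`, type 2 `ρ = 0`, type 3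
`ρ = √(2τε)` and `ε`-part `0`). Then for every `x ∈ dom g`, `y ∈ dom h*`:
`L(x̌, y) − L(x, y̌) ≤ ‖x − x̄‖²/2τ + ‖y − ȳ‖²/2σ − ‖x − x̌‖²/2τ − ‖x̄ − x̌‖²/2τ − ‖y − y̌‖²/2σ − ‖ȳ − y̌‖²/2σ
  + ⟪K(x − x̌), ỹ − y̌⟫ − ⟪K(x̃ − x̌), y − y̌⟫ + (‖e‖ + ρ/τ)‖x − x̌‖ + ε + δ`
(for `ρ = √(2τε)`: `ρ/τ = √(2ε/τ)`, the printed constant). The smooth term `f` with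
`L_f`-Lipschitz gradient of the paper is taken `= 0` here (`L_f = 0`); TODO(general form): `f ≠ 0`
changes `−‖x̄ − x̌‖²/2τ` into `−(1 − τL_f)‖x̄ − x̌‖²/2τ` via the descent lemma (3.8).
[cite: RaschChambolle2020, Lemma 3.1] -/
theorem general_inequality (K : X →L[ℝ] Y) {g : X → ℝ} {hs : Y → ℝ} {C : Set X} {D : Set Y}
    {τ σ ρ ε δ : ℝ} (hτ : 0 < τ) (hσ : 0 < σ) {xb xt xc e : X} {yb yt yc : Y}
    (hyc : IsType2ProxPt D hs σ δ (yb + σ • K xt) yc)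
    (hxc : IsApproxProxPt C g τ ρ ε (xb - τ • (K.adjoint yt + e)) xc)
    {x : X} (hxC : x ∈ C) {y : Y} (hyD : y ∈ D) :
    lagr K g hs xc y - lagr K g hs x yc ≤
      ‖x - xb‖ ^ 2 / (2 * τ) + ‖y - yb‖ ^ 2 / (2 * σ) - ‖x - xc‖ ^ 2 / (2 * τ)
        - ‖xb - xc‖ ^ 2 / (2 * τ) - ‖y - yc‖ ^ 2 / (2 * σ) - ‖yb - yc‖ ^ 2 / (2 * σ)
        + ⟪K (x - xc), yt - yc⟫ - ⟪K (xt - xc), y - yc⟫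
        + (‖e‖ + ρ / τ) * ‖x - xc‖ + ε + δ := by
  -- the dual `ε`-subgradient inequality (3.6)
  have hD := hyc.2 y hyD
  have eD : ⟪yc - (yb + σ • K xt), y - yc⟫ = ⟪yc - yb, y - yc⟫ - σ * ⟪K xt, y - yc⟫ := by
    have : yc - (yb + σ • K xt) = (yc - yb) - σ • K xt := by abel
    rw [this, inner_sub_left, real_inner_smul_left]
  have cD := two_inner_sub_sub yc yb y
  -- `hs yc − hs y ≤ (‖y−ȳ‖² − ‖ȳ−y̌‖² − ‖y−y̌‖²)/(2σ) − ⟪K x̃, y − y̌⟫ + δ`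
  have hD' : hs yc - hs y ≤
      (‖y - yb‖ ^ 2 - ‖yb - yc‖ ^ 2 - ‖y - yc‖ ^ 2) / (2 * σ) - ⟪K xt, y - yc⟫ + δ := by
    have e1 : (‖y - yb‖ ^ 2 - ‖yb - yc‖ ^ 2 - ‖y - yc‖ ^ 2) / (2 * σ) - ⟪K xt, y - yc⟫ + δ =
        ((‖y - yb‖ ^ 2 - ‖yb - yc‖ ^ 2 - ‖y - yc‖ ^ 2) / 2 - σ * ⟪K xt, y - yc⟫ + σ * δ) / σ := by
      field_simp
    rw [e1, le_div_iff₀ hσ]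
    have n1 : ‖yb - y‖ = ‖y - yb‖ := norm_sub_rev _ _
    have n2 : ‖yc - yb‖ = ‖yb - yc‖ := norm_sub_rev _ _
    have n3 : ‖yc - y‖ = ‖y - yc‖ := norm_sub_rev _ _
    rw [n1, n2, n3] at cD
    nlinarith [hD, eD, cD]
  -- the primal approximate-prox inequality (3.7)
  obtain ⟨hxcC, r, hr, hP⟩ := hxc
  have hP1 := hP x hxC
  have eP : ⟪xc + r - (xb - τ • (K.adjoint yt + e)), x - xc⟫ =
      ⟪xc - xb, x - xc⟫ + τ * ⟪K (x - xc), yt⟫ + τ * ⟪e, x - xc⟫ + ⟪r, x - xc⟫ := by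
    have : xc + r - (xb - τ • (K.adjoint yt + e)) =
        (xc - xb) + τ • K.adjoint yt + τ • e + r := by
      simp only [smul_add]; abel
    rw [this, inner_add_left, inner_add_left, inner_add_left, real_inner_smul_left,
      real_inner_smul_left, ContinuousLinearMap.adjoint_inner_left, real_inner_comm (K (x - xc))]
  have cP := two_inner_sub_sub xc xb x
  have hcs1 : ⟪e, x - xc⟫ ≤ ‖e‖ * ‖x - xc‖ := real_inner_le_norm _ _
  have hcs2 : ⟪r, x - xc⟫ ≤ ρ * ‖x - xc‖ :=
    (real_inner_le_norm _ _).trans (mul_le_mul_of_nonneg_right hr (norm_nonneg _))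
  have hP' : g xc - g x ≤ (‖x - xb‖ ^ 2 - ‖xb - xc‖ ^ 2 - ‖x - xc‖ ^ 2) / (2 * τ)
      + ⟪K (x - xc), yt⟫ + (‖e‖ + ρ / τ) * ‖x - xc‖ + ε := by
    have e1 : (‖x - xb‖ ^ 2 - ‖xb - xc‖ ^ 2 - ‖x - xc‖ ^ 2) / (2 * τ)
        + ⟪K (x - xc), yt⟫ + (‖e‖ + ρ / τ) * ‖x - xc‖ + ε =
        ((‖x - xb‖ ^ 2 - ‖xb - xc‖ ^ 2 - ‖x - xc‖ ^ 2) / 2 + τ * ⟪K (x - xc), yt⟫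
          + (τ * ‖e‖ + ρ) * ‖x - xc‖ + τ * ε) / τ := by
      field_simp
    rw [e1, le_div_iff₀ hτ]
    have n1 : ‖xb - x‖ = ‖x - xb‖ := norm_sub_rev _ _
    have n2 : ‖xc - xb‖ = ‖xb - xc‖ := norm_sub_rev _ _
    have n3 : ‖xc - x‖ = ‖x - xc‖ := norm_sub_rev _ _
    rw [n1, n2, n3] at cP
    have hτe : τ * ⟪e, x - xc⟫ ≤ τ * (‖e‖ * ‖x - xc‖) := mul_le_mul_of_nonneg_left hcs1 hτ.le
    nlinarith [hP1, eP, cP, hτe, hcs2]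
  -- combine: the cross terms regroup exactly
  have ecross : ⟪K (x - xc), yt⟫ - ⟪K xt, y - yc⟫ + ⟪K xc, y⟫ - ⟪K x, yc⟫ =
      ⟪K (x - xc), yt - yc⟫ - ⟪K (xt - xc), y - yc⟫ := by
    simp only [map_sub, inner_sub_left, inner_sub_right]
    ring
  have split1 : (‖x - xb‖ ^ 2 - ‖xb - xc‖ ^ 2 - ‖x - xc‖ ^ 2) / (2 * τ) =
      ‖x - xb‖ ^ 2 / (2 * τ) - ‖xb - xc‖ ^ 2 / (2 * τ) - ‖x - xc‖ ^ 2 / (2 * τ) := by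
    rw [sub_div, sub_div]
  have split2 : (‖y - yb‖ ^ 2 - ‖yb - yc‖ ^ 2 - ‖y - yc‖ ^ 2) / (2 * σ) =
      ‖y - yb‖ ^ 2 / (2 * σ) - ‖yb - yc‖ ^ 2 / (2 * σ) - ‖y - yc‖ ^ 2 / (2 * σ) := by
    rw [sub_div, sub_div]
  unfold lagr
  linarith [hD', hP', ecross, split1, split2]

end GeneralInequality

/-! ### Algorithm (3.10): inexact PDHG (no acceleration), and Theorem 3.2 -/

section Algorithm

variable [CompleteSpace X] [CompleteSpace Y]

/-- `x^{n−1}`, with the convention `x^{−1} = x^0` of the proof of Theorem 3.2.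
[cite: RaschChambolle2020, Thm 3.2 (proof: "we let `x^0 = x^{−1}`")] -/
def xprev {E : Type*} (x : ℕ → E) : ℕ → E
  | 0 => x 0
  | n + 1 => x n

/-- `x^{−1} = x^0`. [cite: RaschChambolle2020, Thm 3.2 (proof)] -/
@[simp] theorem xprev_zero {E : Type*} (x : ℕ → E) : xprev x 0 = x 0 := rfl

/-- `x^{(n+1)−1} = x^n`. [cite: RaschChambolle2020, Thm 3.2 (proof)] -/
@[simp] theorem xprev_succ {E : Type*} (x : ℕ → E) (n : ℕ) : xprev x (n + 1) = x n := rfl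

/-- **Algorithm (3.10)** (the choice (3.9) in (3.5)) as a run: for every `n ≥ 0`,
`y^{n+1} ≈₂^{δ_{n+1}} prox_{σ h*}(y^n + σ K(2x^n − x^{n−1}))` (type-2, relative to `D = dom h*`) and
`x^{n+1} ≈^{(ρ_{n+1}, ε_{n+1})} prox_{τ g}(x^n − τ (K* y^{n+1} + e^{n+1}))` in the common form of a
type-1/2/3 approximation (`IsApproxProxPt`, relative to `C = dom g`; type `i = 1`: `ρ_n = √(2τε_n)`,
type 2: `ρ_n = 0`, type 3: `ρ_n = √(2τε_n)` with `ε`-part `0`), `e^{n+1}` an error in the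
linear/gradient part; `x^{−1} = x^0`. The smooth term `f` of the paper is `0` here. The error
sequences are indexed so that index `n + 1` belongs to the step `n → n + 1` (index `0` is unused).
[cite: RaschChambolle2020, §3.1 (3.10)] -/
structure IsInexactPDHGRun (K : X →L[ℝ] Y) (g : X → ℝ) (hs : Y → ℝ) (C : Set X) (D : Set Y)
    (τ σ : ℝ) (x : ℕ → X) (y : ℕ → Y) (e : ℕ → X) (ρ ε δ : ℕ → ℝ) : Prop where
  /-- the dual step, a type-2 approximation with precision `δ_{n+1}` -/
  dual : ∀ n, IsType2ProxPt D hs σ (δ (n + 1)) (y n + σ • K ((2 : ℝ) • x n - xprev x n)) (y (n + 1))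
  /-- the primal step, a type-1/2/3 approximation in the common form, with gradient error `e^{n+1}` -/
  primal : ∀ n, IsApproxProxPt C g τ (ρ (n + 1)) (ε (n + 1))
    (x n - τ • (K.adjoint (y (n + 1)) + e (n + 1))) (x (n + 1))

/-- `A_N = Σ_{n=1}^N (τ ‖e^n‖ + ρ_n)` — for type 1: `Σ (τ‖e^n‖ + √(2τε_n)) = A_{N,1}`; type 2:
`Σ τ‖e^n‖ = A_{N,2}`; type 3: `A_{N,3} = A_{N,1}`. [cite: RaschChambolle2020, Thm 3.2 (A_{N,i})] -/
noncomputable def errA {E : Type*} [NormedAddCommGroup E] (τ : ℝ) (e : ℕ → E) (ρ : ℕ → ℝ)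
    (N : ℕ) : ℝ :=
  ∑ n ∈ Finset.range N, (τ * ‖e (n + 1)‖ + ρ (n + 1))

/-- `B_N = Σ_{n=1}^N τ (ε_n + δ_n)` (`= B_{N,1} = B_{N,2}`; type 3 has `ε`-part `0`, `B_{N,3} = Σ τδ_n`).
[cite: RaschChambolle2020, Thm 3.2 (B_{N,i})] -/
noncomputable def errB (τ : ℝ) (ε δ : ℕ → ℝ) (N : ℕ) : ℝ :=
  ∑ n ∈ Finset.range N, τ * (ε (n + 1) + δ (n + 1))

/-- The ergodic average `Z^N = (Σ_{n=1}^N z^n)/N`. [cite: RaschChambolle2020, Thm 3.2 (X^N, Y^N)] -/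
noncomputable def erg {E : Type*} [AddCommGroup E] [Module ℝ E] (z : ℕ → E) (N : ℕ) : E :=
  (N : ℝ)⁻¹ • ∑ n ∈ Finset.range N, z (n + 1)

omit [CompleteSpace X] [CompleteSpace Y] in
/-- `A_N ≥ 0` when `ρ ≥ 0`. [cite: RaschChambolle2020, Thm 3.2] -/
theorem errA_nonneg {E : Type*} [NormedAddCommGroup E] {τ : ℝ} (hτ : 0 ≤ τ) {e : ℕ → E}
    {ρ : ℕ → ℝ} (hρ : ∀ n, 0 ≤ ρ n) (N : ℕ) : 0 ≤ errA τ e ρ N :=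
  Finset.sum_nonneg fun _ _ => add_nonneg (mul_nonneg hτ (norm_nonneg _)) (hρ _)

omit [CompleteSpace X] [CompleteSpace Y] in
/-- `B_N ≥ 0` when `ε, δ ≥ 0`. [cite: RaschChambolle2020, Thm 3.2] -/
theorem errB_nonneg {τ : ℝ} (hτ : 0 ≤ τ) {ε δ : ℕ → ℝ} (hε : ∀ n, 0 ≤ ε n) (hδ : ∀ n, 0 ≤ δ n)
    (N : ℕ) : 0 ≤ errB τ ε δ N :=
  Finset.sum_nonneg fun _ _ => mul_nonneg hτ (add_nonneg (hε _) (hδ _))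

omit [CompleteSpace X] [CompleteSpace Y] in
/-- `A_N` is nondecreasing in `N`. [cite: RaschChambolle2020, Thm 3.2 (proof: "since A_N and B_N are increasing")] -/
theorem errA_mono {E : Type*} [NormedAddCommGroup E] {τ : ℝ} (hτ : 0 ≤ τ) {e : ℕ → E} {ρ : ℕ → ℝ}
    (hρ : ∀ n, 0 ≤ ρ n) : Monotone (errA τ e ρ) :=
  fun _ _ h => Finset.sum_le_sum_of_subset_of_nonneg (Finset.range_mono h)
    fun _ _ _ => add_nonneg (mul_nonneg hτ (norm_nonneg _)) (hρ _)

omit [CompleteSpace X] [CompleteSpace Y] in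
/-- `B_N` is nondecreasing in `N`. [cite: RaschChambolle2020, Thm 3.2 (proof)] -/
theorem errB_mono {τ : ℝ} (hτ : 0 ≤ τ) {ε δ : ℕ → ℝ} (hε : ∀ n, 0 ≤ ε n) (hδ : ∀ n, 0 ≤ δ n) :
    Monotone (errB τ ε δ) :=
  fun _ _ h => Finset.sum_le_sum_of_subset_of_nonneg (Finset.range_mono h)
    fun _ _ _ => mul_nonneg hτ (add_nonneg (hε _) (hδ _))

omit [CompleteSpace X] [CompleteSpace Y] in
/-- Young's inequality in the form used twice in the proof of Theorem 3.2:
`L p q ≤ L² p²/(2c) + c q²/2` (`c > 0`). [cite: RaschChambolle2020, Thm 3.2 (proof, (3.11))] -/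
theorem young_split {c : ℝ} (hc : 0 < c) (L p q : ℝ) :
    L * p * q ≤ L ^ 2 * p ^ 2 / (2 * c) + c * q ^ 2 / 2 := by
  rw [div_add_div _ _ (by positivity) (by norm_num), le_div_iff₀ (by positivity)]
  nlinarith [sq_nonneg (L * p - c * q), hc]

omit [CompleteSpace X] [CompleteSpace Y] in
/-- `|⟪K a, b⟫| ≤ ‖K‖ ‖a‖ ‖b‖`. [cite: RaschChambolle2020, Thm 3.2 (proof, (3.11))] -/
theorem abs_inner_le_opNorm (K : X →L[ℝ] Y) (a : X) (b : Y) : |⟪K a, b⟫| ≤ ‖K‖ * ‖a‖ * ‖b‖ :=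
  (abs_real_inner_le_norm _ _).trans (mul_le_mul_of_nonneg_right (K.le_opNorm a) (norm_nonneg _))

namespace IsInexactPDHGRun

variable {K : X →L[ℝ] Y} {g : X → ℝ} {hs : Y → ℝ} {C : Set X} {D : Set Y} {τ σ : ℝ}
  {x : ℕ → X} {y : ℕ → Y} {e : ℕ → X} {ρ ε δ : ℕ → ℝ}

/-- A run with type-2 primal steps (`ρ = 0`, "the most interesting one in terms of practicability").
[cite: RaschChambolle2020, §3.1 (3.10) with i = 2] -/
theorem of_type2
    (hdual : ∀ n, IsType2ProxPt D hs σ (δ (n + 1)) (y n + σ • K ((2 : ℝ) • x n - xprev x n))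
      (y (n + 1)))
    (hprimal : ∀ n, IsType2ProxPt C g τ (ε (n + 1)) (x n - τ • (K.adjoint (y (n + 1)) + e (n + 1)))
      (x (n + 1))) :
    IsInexactPDHGRun K g hs C D τ σ x y e (fun _ => 0) ε δ :=
  ⟨hdual, fun n => (hprimal n).isApproxProxPt⟩

/-- The primal iterates `x^{n+1}` lie in `dom g`. [cite: RaschChambolle2020, §3.1 (3.10)] -/
theorem x_succ_mem (h : IsInexactPDHGRun K g hs C D τ σ x y e ρ ε δ) (n : ℕ) : x (n + 1) ∈ C :=
  (h.primal n).1

/-- The dual iterates `y^{n+1}` lie in `dom h*`. [cite: RaschChambolle2020, §3.1 (3.10)] -/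
theorem y_succ_mem (h : IsInexactPDHGRun K g hs C D τ σ x y e ρ ε δ) (n : ℕ) : y (n + 1) ∈ D :=
  (h.dual n).1

/-- The per-step inequality (3.12) (with `L_f = 0`, `β = 0`): Lemma 3.1 with the choices (3.9), the
cross term expanded and its middle part bounded by Young's inequality (3.11) with `α = σL`.
[cite: RaschChambolle2020, Thm 3.2 (proof, (3.12))] -/
theorem step_le (h : IsInexactPDHGRun K g hs C D τ σ x y e ρ ε δ) (hτ : 0 < τ) (hσ : 0 < σ)
    {xx : X} (hxx : xx ∈ C) {yy : Y} (hyy : yy ∈ D) (n : ℕ) :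
    lagr K g hs (x (n + 1)) yy - lagr K g hs xx (y (n + 1)) ≤
      (‖xx - x n‖ ^ 2 / (2 * τ) - ‖xx - x (n + 1)‖ ^ 2 / (2 * τ))
      + (‖yy - y n‖ ^ 2 / (2 * σ) - ‖yy - y (n + 1)‖ ^ 2 / (2 * σ))
      - ‖x (n + 1) - x n‖ ^ 2 / (2 * τ) + τ * σ * ‖K‖ ^ 2 * (‖x n - xprev x n‖ ^ 2 / (2 * τ))
      + (⟪K (x (n + 1) - x n), yy - y (n + 1)⟫ - ⟪K (x n - xprev x n), yy - y n⟫)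
      + ((‖e (n + 1)‖ + ρ (n + 1) / τ) * ‖xx - x (n + 1)‖ + ε (n + 1) + δ (n + 1)) := by
  have hgi := general_inequality K hτ hσ (h.dual n) (h.primal n) hxx hyy
  have e0 : ⟪K (xx - x (n + 1)), y (n + 1) - y (n + 1)⟫ = 0 := by
    rw [sub_self, inner_zero_right]
  have e3 : ⟪K (x n - xprev x n), yy - y (n + 1)⟫ =
      ⟪K (x n - xprev x n), yy - y n⟫ + ⟪K (x n - xprev x n), y n - y (n + 1)⟫ := by
    rw [← inner_add_right]; congr 1; abel
  have esplit : ⟪K ((2 : ℝ) • x n - xprev x n - x (n + 1)), yy - y (n + 1)⟫ =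
      ⟪K (x n - xprev x n), yy - y n⟫ + ⟪K (x n - xprev x n), y n - y (n + 1)⟫
        - ⟪K (x (n + 1) - x n), yy - y (n + 1)⟫ := by
    have e1 : (2 : ℝ) • x n - xprev x n - x (n + 1) = (x n - xprev x n) - (x (n + 1) - x n) := by
      rw [two_smul]; abel
    rw [e1, map_sub, inner_sub_left, e3]
  -- Young: `−⟪K(x^n − x^{n−1}), y^n − y^{n+1}⟫ ≤ τσL² ‖x^n − x^{n−1}‖²/2τ + ‖y^n − y^{n+1}‖²/2σ`
  have hy1 := abs_inner_le_opNorm K (x n - xprev x n) (y n - y (n + 1))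
  have hy2 := young_split (c := 1 / σ) (by positivity) ‖K‖ ‖x n - xprev x n‖ ‖y n - y (n + 1)‖
  have ey : ‖K‖ ^ 2 * ‖x n - xprev x n‖ ^ 2 / (2 * (1 / σ)) + 1 / σ * ‖y n - y (n + 1)‖ ^ 2 / 2 =
      τ * σ * ‖K‖ ^ 2 * (‖x n - xprev x n‖ ^ 2 / (2 * τ)) + ‖y n - y (n + 1)‖ ^ 2 / (2 * σ) := by
    field_simp
  have hy3 := neg_abs_le ⟪K (x n - xprev x n), y n - y (n + 1)⟫
  have n1 : ‖x n - x (n + 1)‖ = ‖x (n + 1) - x n‖ := norm_sub_rev _ _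
  have n2 : ‖y n - y (n + 1)‖ = ‖y n - y (n + 1)‖ := rfl
  rw [e0, esplit, n1] at hgi
  linarith [hgi, hy1, hy2, ey, hy3]

/-- Summing (3.12) from `0` to `N − 1` (with `x^{−1} = x^0`): the telescoped inequality, keeping the
last cross term `⟪K(x^N − x^{N−1}), y − y^N⟫` and `−‖x^N − x^{N−1}‖²/2τ`, for `τσ‖K‖² ≤ 1`.
[cite: RaschChambolle2020, Thm 3.2 (proof, display before (3.13))] -/
theorem sum_gap_le_aux (h : IsInexactPDHGRun K g hs C D τ σ x y e ρ ε δ) (hτ : 0 < τ) (hσ : 0 < σ)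
    (hK : τ * σ * ‖K‖ ^ 2 ≤ 1) {xx : X} (hxx : xx ∈ C) {yy : Y} (hyy : yy ∈ D) (N : ℕ) :
    ∑ n ∈ Finset.range N, (lagr K g hs (x (n + 1)) yy - lagr K g hs xx (y (n + 1))) ≤
      ‖xx - x 0‖ ^ 2 / (2 * τ) + ‖yy - y 0‖ ^ 2 / (2 * σ)
        - ‖xx - x N‖ ^ 2 / (2 * τ) - ‖yy - y N‖ ^ 2 / (2 * σ)
        - ‖x N - xprev x N‖ ^ 2 / (2 * τ) + ⟪K (x N - xprev x N), yy - y N⟫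
        + ∑ n ∈ Finset.range N,
            ((‖e (n + 1)‖ + ρ (n + 1) / τ) * ‖xx - x (n + 1)‖ + ε (n + 1) + δ (n + 1)) := by
  induction N with
  | zero => simp
  | succ N ih =>
      rw [Finset.sum_range_succ, Finset.sum_range_succ]
      have hs := h.step_le hτ hσ hxx hyy N
      have hd : 0 ≤ ‖x N - xprev x N‖ ^ 2 / (2 * τ) := by positivity
      have hk : τ * σ * ‖K‖ ^ 2 * (‖x N - xprev x N‖ ^ 2 / (2 * τ)) ≤
          ‖x N - xprev x N‖ ^ 2 / (2 * τ) := mul_le_of_le_one_left hd hK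
      simp only [xprev_succ]
      linarith [ih, hs, hk]

/-- **(3.13)**: for `τσ‖K‖² ≤ 1` and every `x ∈ dom g`, `y ∈ dom h*`,
`Σ_{n=1}^N [L(x^n, y) − L(x, y^n)] + ‖x − x^N‖²/2τ + (1 − τσL²)‖y − y^N‖²/2σ
  ≤ ‖x − x^0‖²/2τ + ‖y − y^0‖²/2σ + Σ_{n=1}^N [(‖e^n‖ + ρ_n/τ)‖x − x^n‖ + ε_n + δ_n]`
(the nonpositive terms `−κ Σ‖x^n − x^{n−1}‖²/2τ` are dropped; `L_f = 0`, `β = 0`).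
[cite: RaschChambolle2020, Thm 3.2 (proof, (3.13))] -/
theorem sum_gap_add_le (h : IsInexactPDHGRun K g hs C D τ σ x y e ρ ε δ) (hτ : 0 < τ) (hσ : 0 < σ)
    (hK : τ * σ * ‖K‖ ^ 2 ≤ 1) {xx : X} (hxx : xx ∈ C) {yy : Y} (hyy : yy ∈ D) (N : ℕ) :
    ∑ n ∈ Finset.range N, (lagr K g hs (x (n + 1)) yy - lagr K g hs xx (y (n + 1)))
      + ‖xx - x N‖ ^ 2 / (2 * τ) + (1 - τ * σ * ‖K‖ ^ 2) * (‖yy - y N‖ ^ 2 / (2 * σ)) ≤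
      ‖xx - x 0‖ ^ 2 / (2 * τ) + ‖yy - y 0‖ ^ 2 / (2 * σ)
        + ∑ n ∈ Finset.range N,
            ((‖e (n + 1)‖ + ρ (n + 1) / τ) * ‖xx - x (n + 1)‖ + ε (n + 1) + δ (n + 1)) := by
  have h1 := h.sum_gap_le_aux hτ hσ hK hxx hyy N
  have hy1 := abs_inner_le_opNorm K (x N - xprev x N) (yy - y N)
  have hy2 := young_split (c := 1 / τ) (by positivity) ‖K‖ ‖yy - y N‖ ‖x N - xprev x N‖
  have ey : ‖K‖ ^ 2 * ‖yy - y N‖ ^ 2 / (2 * (1 / τ)) + 1 / τ * ‖x N - xprev x N‖ ^ 2 / 2 =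
      τ * σ * ‖K‖ ^ 2 * (‖yy - y N‖ ^ 2 / (2 * σ)) + ‖x N - xprev x N‖ ^ 2 / (2 * τ) := by
    field_simp
  have hy3 := le_abs_self ⟪K (x N - xprev x N), yy - y N⟫
  have hc : ‖K‖ * ‖x N - xprev x N‖ * ‖yy - y N‖ = ‖K‖ * ‖yy - y N‖ * ‖x N - xprev x N‖ := by
    ring
  nlinarith [h1, hy1, hy2, ey, hy3, hc]

variable {xs : X} {ys : Y}

/-- At a saddle point each summand `L(x^n, ŷ) − L(x̂, y^n)` is nonnegative.
[cite: RaschChambolle2020, Thm 3.2 (proof: "such that the sum on the left hand side is nonnegative")] -/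
theorem gap_nonneg (h : IsInexactPDHGRun K g hs C D τ σ x y e ρ ε δ)
    (hsad : IsSaddleOn K g hs C D xs ys) (n : ℕ) :
    0 ≤ lagr K g hs (x (n + 1)) ys - lagr K g hs xs (y (n + 1)) := by
  have h1 := hsad.2.2.1 (x (n + 1)) (h.x_succ_mem n)
  have h2 := hsad.2.2.2 (y (n + 1)) (h.y_succ_mem n)
  linarith

/-- The recursion fed into Lemma 6.1: `‖x̂ − x^N‖² ≤ S_N + Σ_{n=1}^N λ_n ‖x̂ − x^n‖` with
`S_N = ‖x̂ − x^0‖² + (τ/σ)‖ŷ − y^0‖² + 2B_N`, `λ_n = 2(τ‖e^n‖ + ρ_n)`.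
[cite: RaschChambolle2020, Thm 3.2 (proof, after (3.13))] -/
theorem norm_sub_sq_le_rec (h : IsInexactPDHGRun K g hs C D τ σ x y e ρ ε δ) (hτ : 0 < τ)
    (hσ : 0 < σ) (hK : τ * σ * ‖K‖ ^ 2 ≤ 1) (hsad : IsSaddleOn K g hs C D xs ys) (N : ℕ) :
    ‖xs - x N‖ ^ 2 ≤ (‖xs - x 0‖ ^ 2 + τ / σ * ‖ys - y 0‖ ^ 2 + 2 * errB τ ε δ N)
      + ∑ n ∈ Finset.range N, (2 * (τ * ‖e (n + 1)‖ + ρ (n + 1))) * ‖xs - x (n + 1)‖ := by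
  have h1 := h.sum_gap_add_le hτ hσ hK hsad.1 hsad.2.1 N
  have hg : 0 ≤ ∑ n ∈ Finset.range N, (lagr K g hs (x (n + 1)) ys - lagr K g hs xs (y (n + 1))) :=
    Finset.sum_nonneg fun n _ => h.gap_nonneg hsad n
  have hy : 0 ≤ (1 - τ * σ * ‖K‖ ^ 2) * (‖ys - y N‖ ^ 2 / (2 * σ)) :=
    mul_nonneg (by linarith) (by positivity)
  have h2 : ‖xs - x N‖ ^ 2 / (2 * τ) ≤ ‖xs - x 0‖ ^ 2 / (2 * τ) + ‖ys - y 0‖ ^ 2 / (2 * σ)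
      + ∑ n ∈ Finset.range N,
          ((‖e (n + 1)‖ + ρ (n + 1) / τ) * ‖xs - x (n + 1)‖ + ε (n + 1) + δ (n + 1)) := by
    linarith
  have h3 := mul_le_mul_of_nonneg_left h2 (by positivity : (0 : ℝ) ≤ 2 * τ)
  have eL : 2 * τ * (‖xs - x N‖ ^ 2 / (2 * τ)) = ‖xs - x N‖ ^ 2 := by field_simp
  have eR : 2 * τ * (‖xs - x 0‖ ^ 2 / (2 * τ) + ‖ys - y 0‖ ^ 2 / (2 * σ)
      + ∑ n ∈ Finset.range N,
          ((‖e (n + 1)‖ + ρ (n + 1) / τ) * ‖xs - x (n + 1)‖ + ε (n + 1) + δ (n + 1))) =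
      (‖xs - x 0‖ ^ 2 + τ / σ * ‖ys - y 0‖ ^ 2 + 2 * errB τ ε δ N)
      + ∑ n ∈ Finset.range N, (2 * (τ * ‖e (n + 1)‖ + ρ (n + 1))) * ‖xs - x (n + 1)‖ := by
    have et : ∀ n ∈ Finset.range N,
        2 * τ * ((‖e (n + 1)‖ + ρ (n + 1) / τ) * ‖xs - x (n + 1)‖ + ε (n + 1) + δ (n + 1)) =
          2 * (τ * (ε (n + 1) + δ (n + 1))) + 2 * (τ * ‖e (n + 1)‖ + ρ (n + 1)) * ‖xs - x (n + 1)‖ := by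
      intro n _
      field_simp
      ring
    have eΔ : 2 * τ * (‖xs - x 0‖ ^ 2 / (2 * τ) + ‖ys - y 0‖ ^ 2 / (2 * σ)) =
        ‖xs - x 0‖ ^ 2 + τ / σ * ‖ys - y 0‖ ^ 2 := by
      field_simp
    rw [mul_add, Finset.mul_sum, Finset.sum_congr rfl et, Finset.sum_add_distrib, eΔ, errB,
      Finset.mul_sum]
    ring
  linarith [h3, eL, eR]

/-- The constant `M_N = 2A_N + ‖x^0 − x̂‖ + √(τ/σ)‖y^0 − ŷ‖ + √(2B_N)` of (3.14).
[cite: RaschChambolle2020, Thm 3.2 (proof, (3.14))] -/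
noncomputable def boundM (τ σ : ℝ) (x : ℕ → X) (y : ℕ → Y) (e : ℕ → X) (ρ ε δ : ℕ → ℝ)
    (xs : X) (ys : Y) (N : ℕ) : ℝ :=
  2 * errA τ e ρ N + ‖xs - x 0‖ + Real.sqrt (τ / σ) * ‖ys - y 0‖ + Real.sqrt (2 * errB τ ε δ N)

/-- **(3.14)**: by Lemma 6.1, for all `n ≤ N`,
`‖x^n − x̂‖ ≤ A_N + (2τΔ₀ + 2B_N + A_N²)^{1/2} ≤ 2A_N + ‖x^0 − x̂‖ + √(τ/σ)‖y^0 − ŷ‖ + √(2B_N)` —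
in particular the iterates stay bounded when the errors are summable.
[cite: RaschChambolle2020, Thm 3.2 (proof, (3.14))] -/
theorem norm_sub_le (h : IsInexactPDHGRun K g hs C D τ σ x y e ρ ε δ) (hτ : 0 < τ) (hσ : 0 < σ)
    (hK : τ * σ * ‖K‖ ^ 2 ≤ 1) (hsad : IsSaddleOn K g hs C D xs ys) (hε : ∀ n, 0 ≤ ε n)
    (hδ : ∀ n, 0 ≤ δ n) (hρ : ∀ n, 0 ≤ ρ n) {n N : ℕ} (hn : n ≤ N) :
    ‖xs - x n‖ ≤ boundM τ σ x y e ρ ε δ xs ys N := by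
  -- Lemma 6.1 with `u_n = ‖x̂ − x^n‖`, `S_N = 2τΔ₀ + 2B_N`, `λ_n = 2(τ‖e^n‖ + ρ_n)`
  set S : ℕ → ℝ := fun N => ‖xs - x 0‖ ^ 2 + τ / σ * ‖ys - y 0‖ ^ 2 + 2 * errB τ ε δ N with hS
  set lam : ℕ → ℝ := fun n => 2 * (τ * ‖e n‖ + ρ n) with hlam
  have hlam0 : ∀ n, 0 ≤ lam n := fun n => by
    simp only [hlam]; exact mul_nonneg two_pos.le (add_nonneg (by positivity) (hρ n))
  have hSm : Monotone S := fun a b hab => by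
    simp only [hS]; linarith [errB_mono hτ.le hε hδ hab]
  have hrec : ∀ N, ‖xs - x N‖ ^ 2 ≤ S N + ∑ n ∈ Finset.range N, lam (n + 1) * ‖xs - x (n + 1)‖ :=
    fun N => h.norm_sub_sq_le_rec hτ hσ hK hsad N
  have hmain := le_sbound_of_sq_le (u := fun n => ‖xs - x n‖) hlam0 hSm hrec n
  have hA : lamSum lam n / 2 = errA τ e ρ n := by
    simp only [lamSum, hlam, errA, ← Finset.mul_sum]
    ring
  have hAN := errA_mono hτ.le hρ hn (e := e)
  have hBN := errB_mono hτ.le hε hδ hn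
  have hA0 := errA_nonneg hτ.le hρ N (e := e)
  have hB0 := errB_nonneg hτ.le hε hδ N
  unfold sbound at hmain
  rw [hA] at hmain
  -- `√(S_n + A_n²) ≤ √(S_N + A_N²) ≤ ‖x̂ − x^0‖ + √(τ/σ)‖ŷ − y^0‖ + √(2B_N) + A_N`
  have hsq : Real.sqrt (S n + errA τ e ρ n ^ 2) ≤
      ‖xs - x 0‖ + Real.sqrt (τ / σ) * ‖ys - y 0‖ + Real.sqrt (2 * errB τ ε δ N) + errA τ e ρ N := by
    have hmono : S n + errA τ e ρ n ^ 2 ≤ S N + errA τ e ρ N ^ 2 := by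
      have := hSm hn
      nlinarith [errA_nonneg hτ.le hρ n (e := e)]
    refine (Real.sqrt_le_sqrt hmono).trans ?_
    rw [Real.sqrt_le_left (by positivity)]
    have e1 : (Real.sqrt (τ / σ) * ‖ys - y 0‖) ^ 2 = τ / σ * ‖ys - y 0‖ ^ 2 := by
      rw [mul_pow, Real.sq_sqrt (by positivity)]
    have e2 : Real.sqrt (2 * errB τ ε δ N) ^ 2 = 2 * errB τ ε δ N := Real.sq_sqrt (by positivity)
    have p1 : 0 ≤ Real.sqrt (τ / σ) * ‖ys - y 0‖ := by positivity
    have p2 : 0 ≤ Real.sqrt (2 * errB τ ε δ N) := Real.sqrt_nonneg _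
    have p3 : 0 ≤ ‖xs - x 0‖ := norm_nonneg _
    simp only [hS]
    nlinarith [mul_nonneg p1 p2, mul_nonneg p1 p3, mul_nonneg p2 p3, mul_nonneg hA0 p1,
      mul_nonneg hA0 p2, mul_nonneg hA0 p3]
  unfold boundM
  linarith [hmain, hsq, hAN]

/-- **(3.15)**: the error terms are bounded by the initialisation and the error sums:
`Δ₀ + Σ_{n=1}^N [(‖e^n‖ + ρ_n/τ)‖x̂ − x^n‖ + ε_n + δ_n] ≤ (‖x^0 − x̂‖ + √(τ/σ)‖y^0 − ŷ‖ + 2A_N + √(2B_N))²/2τ`.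
[cite: RaschChambolle2020, Thm 3.2 (proof, (3.15))] -/
theorem init_add_sum_err_le (h : IsInexactPDHGRun K g hs C D τ σ x y e ρ ε δ) (hτ : 0 < τ)
    (hσ : 0 < σ) (hK : τ * σ * ‖K‖ ^ 2 ≤ 1) (hsad : IsSaddleOn K g hs C D xs ys)
    (hε : ∀ n, 0 ≤ ε n) (hδ : ∀ n, 0 ≤ δ n) (hρ : ∀ n, 0 ≤ ρ n) (N : ℕ) :
    ‖xs - x 0‖ ^ 2 / (2 * τ) + ‖ys - y 0‖ ^ 2 / (2 * σ)
      + ∑ n ∈ Finset.range N,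
          ((‖e (n + 1)‖ + ρ (n + 1) / τ) * ‖xs - x (n + 1)‖ + ε (n + 1) + δ (n + 1)) ≤
      (‖xs - x 0‖ + Real.sqrt (τ / σ) * ‖ys - y 0‖ + 2 * errA τ e ρ N
        + Real.sqrt (2 * errB τ ε δ N)) ^ 2 / (2 * τ) := by
  set M := boundM τ σ x y e ρ ε δ xs ys N with hM
  have hA0 := errA_nonneg hτ.le hρ N (e := e)
  have hB0 := errB_nonneg hτ.le hε hδ N
  -- each `‖x̂ − x^n‖ ≤ M_N`
  have hsum : ∑ n ∈ Finset.range N,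
      ((‖e (n + 1)‖ + ρ (n + 1) / τ) * ‖xs - x (n + 1)‖ + ε (n + 1) + δ (n + 1)) ≤
      errA τ e ρ N / τ * M + errB τ ε δ N / τ := by
    have hle : ∀ n ∈ Finset.range N,
        (‖e (n + 1)‖ + ρ (n + 1) / τ) * ‖xs - x (n + 1)‖ + ε (n + 1) + δ (n + 1) ≤
          (‖e (n + 1)‖ + ρ (n + 1) / τ) * M + (ε (n + 1) + δ (n + 1)) := by
      intro n hn
      have hc : 0 ≤ ‖e (n + 1)‖ + ρ (n + 1) / τ := by positivity [hρ (n + 1)]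
      have := mul_le_mul_of_nonneg_left
        (h.norm_sub_le hτ hσ hK hsad hε hδ hρ (Finset.mem_range.1 hn)) hc
      linarith
    refine (Finset.sum_le_sum hle).trans (le_of_eq ?_)
    rw [Finset.sum_add_distrib, ← Finset.sum_mul, errA, errB, Finset.sum_div, Finset.sum_div]
    congr 1
    · congr 1
      refine Finset.sum_congr rfl fun n _ => ?_
      field_simp
    · refine Finset.sum_congr rfl fun n _ => ?_
      field_simp
  -- the scalar inequality
  have e1 : (Real.sqrt (τ / σ) * ‖ys - y 0‖) ^ 2 = τ / σ * ‖ys - y 0‖ ^ 2 := by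
    rw [mul_pow, Real.sq_sqrt (by positivity)]
  have e2 : Real.sqrt (2 * errB τ ε δ N) ^ 2 = 2 * errB τ ε δ N := Real.sq_sqrt (by positivity)
  have p1 : 0 ≤ Real.sqrt (τ / σ) * ‖ys - y 0‖ := by positivity
  have p2 : 0 ≤ Real.sqrt (2 * errB τ ε δ N) := Real.sqrt_nonneg _
  have p3 : 0 ≤ ‖xs - x 0‖ := norm_nonneg _
  have eΔ : ‖ys - y 0‖ ^ 2 / (2 * σ) = (τ / σ * ‖ys - y 0‖ ^ 2) / (2 * τ) := by
    field_simp
  have key : ‖xs - x 0‖ ^ 2 + τ / σ * ‖ys - y 0‖ ^ 2 + 2 * (errA τ e ρ N * M) + 2 * errB τ ε δ N ≤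
      (‖xs - x 0‖ + Real.sqrt (τ / σ) * ‖ys - y 0‖ + 2 * errA τ e ρ N
        + Real.sqrt (2 * errB τ ε δ N)) ^ 2 := by
    simp only [hM, boundM]
    nlinarith [mul_nonneg p1 p2, mul_nonneg p1 p3, mul_nonneg p2 p3, mul_nonneg hA0 p1,
      mul_nonneg hA0 p2, mul_nonneg hA0 p3]
  have hfin : ‖xs - x 0‖ ^ 2 / (2 * τ) + ‖ys - y 0‖ ^ 2 / (2 * σ)
      + (errA τ e ρ N / τ * M + errB τ ε δ N / τ) =
      (‖xs - x 0‖ ^ 2 + τ / σ * ‖ys - y 0‖ ^ 2 + 2 * (errA τ e ρ N * M) + 2 * errB τ ε δ N)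
        / (2 * τ) := by
    field_simp
    ring
  calc _ ≤ ‖xs - x 0‖ ^ 2 / (2 * τ) + ‖ys - y 0‖ ^ 2 / (2 * σ)
        + (errA τ e ρ N / τ * M + errB τ ε δ N / τ) := by linarith
    _ = _ := hfin
    _ ≤ _ := div_le_div_of_nonneg_right key (by positivity)

/-- **Theorem 3.2, summed form**: at a saddle point `(x̂, ŷ)`,
`Σ_{n=1}^N [L(x^n, ŷ) − L(x̂, y^n)] ≤ (‖x̂ − x^0‖ + √(τ/σ)‖ŷ − y^0‖ + 2A_N + √(2B_N))²/2τ`.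
[cite: RaschChambolle2020, Thm 3.2 (proof, last display)] -/
theorem sum_gap_le (h : IsInexactPDHGRun K g hs C D τ σ x y e ρ ε δ) (hτ : 0 < τ) (hσ : 0 < σ)
    (hK : τ * σ * ‖K‖ ^ 2 ≤ 1) (hsad : IsSaddleOn K g hs C D xs ys) (hε : ∀ n, 0 ≤ ε n)
    (hδ : ∀ n, 0 ≤ δ n) (hρ : ∀ n, 0 ≤ ρ n) (N : ℕ) :
    ∑ n ∈ Finset.range N, (lagr K g hs (x (n + 1)) ys - lagr K g hs xs (y (n + 1))) ≤
      (‖xs - x 0‖ + Real.sqrt (τ / σ) * ‖ys - y 0‖ + 2 * errA τ e ρ N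
        + Real.sqrt (2 * errB τ ε δ N)) ^ 2 / (2 * τ) := by
  have h1 := h.sum_gap_add_le hτ hσ hK hsad.1 hsad.2.1 N
  have h2 := h.init_add_sum_err_le hτ hσ hK hsad hε hδ hρ N
  have hy : 0 ≤ (1 - τ * σ * ‖K‖ ^ 2) * (‖ys - y N‖ ^ 2 / (2 * σ)) :=
    mul_nonneg (by linarith) (by positivity)
  have hxN : 0 ≤ ‖xs - x N‖ ^ 2 / (2 * τ) := by positivity
  linarith

omit [CompleteSpace X] [CompleteSpace Y] in
/-- The ergodic average is the convex combination with weights `1/N`. [cite: RaschChambolle2020, Thm 3.2 (X^N, Y^N)] -/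
theorem erg_eq_sum_smul {E : Type*} [AddCommGroup E] [Module ℝ E] (z : ℕ → E) (N : ℕ) :
    erg z N = ∑ n ∈ Finset.range N, (N : ℝ)⁻¹ • z (n + 1) := by
  rw [erg, Finset.smul_sum]

/-- **Theorem 3.2** [Rasch–Chambolle 2020] (with `f = 0`): let `L = ‖K‖`, `τ, σ > 0` with
`τσL² ≤ 1`, `g`, `h*` convex on their domains `C`, `D`, and let `(x^n, y^n)` be generated by the
inexact primal–dual algorithm (3.10) (dual steps of type 2 with precision `δ_n`, primal steps of
type `i ∈ {1,2,3}` with precision `ε_n` in the common form with radii `ρ_n`, gradient errors `e^n`).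
Then for every `N ≥ 1`, the ergodic averages `X^N = (Σ_{n=1}^N x^n)/N`, `Y^N = (Σ_{n=1}^N y^n)/N`
satisfy, for a saddle point `(x̂, ŷ)`,
`L(X^N, ŷ) − L(x̂, Y^N) ≤ (‖x̂ − x^0‖ + √(τ/σ)‖ŷ − y^0‖ + 2A_N + √(2B_N))² / (2τN)`,
`A_N = Σ_{n=1}^N (τ‖e^n‖ + ρ_n)`, `B_N = Σ_{n=1}^N τ(ε_n + δ_n)` (type 1: `ρ_n = √(2τε_n)`, so
`A_N = A_{N,1}`, `B_N = B_{N,1}`; type 2: `ρ_n = 0`; type 3: `ε`-part `0`). The paper's step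
condition `τL_f + τσL² + τβL < 1` (small `β > 0`) reduces for `f = 0` to `τσL² < 1`; the ergodic
bound itself only needs `τσL² ≤ 1` (`β > 0` serves the convergence of iterates, Thm 3.5).
[cite: RaschChambolle2020, Thm 3.2] -/
theorem ergodic_gap_le (h : IsInexactPDHGRun K g hs C D τ σ x y e ρ ε δ) (hτ : 0 < τ)
    (hσ : 0 < σ) (hK : τ * σ * ‖K‖ ^ 2 ≤ 1) (hg : ConvexOn ℝ C g) (hhs : ConvexOn ℝ D hs)
    (hsad : IsSaddleOn K g hs C D xs ys) (hε : ∀ n, 0 ≤ ε n) (hδ : ∀ n, 0 ≤ δ n)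
    (hρ : ∀ n, 0 ≤ ρ n) {N : ℕ} (hN : 0 < N) :
    lagr K g hs (erg x N) ys - lagr K g hs xs (erg y N) ≤
      (‖xs - x 0‖ + Real.sqrt (τ / σ) * ‖ys - y 0‖ + 2 * errA τ e ρ N
        + Real.sqrt (2 * errB τ ε δ N)) ^ 2 / (2 * τ * N) := by
  have hsum := h.sum_gap_le hτ hσ hK hsad hε hδ hρ N
  have hNr : (0 : ℝ) < N := by exact_mod_cast hN
  -- Jensen for `x ↦ P(x) = L(x, ŷ) − L(x̂, ŷ)` and `y ↦ D(y) = L(x̂, ŷ) − L(x̂, y)`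
  have hw0 : ∀ n ∈ Finset.range N, (0 : ℝ) ≤ (N : ℝ)⁻¹ := fun _ _ => by positivity
  have hw1 : ∑ n ∈ Finset.range N, (N : ℝ)⁻¹ = 1 := by
    rw [Finset.sum_const, Finset.card_range, nsmul_eq_mul, mul_inv_cancel₀ hNr.ne']
  have hP := (LinesearchPDHG.IsLinesearchRun.convexOn_pgap (K := K) hg xs ys).map_sum_le hw0 hw1
    fun n _ => h.x_succ_mem n
  have hD := (LinesearchPDHG.IsLinesearchRun.convexOn_dgap (K := K) hhs xs ys).map_sum_le hw0 hw1
    fun n _ => h.y_succ_mem n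
  rw [← erg_eq_sum_smul] at hP hD
  have egap : lagr K g hs (erg x N) ys - lagr K g hs xs (erg y N) =
      LinesearchPDHG.pgap K g xs ys (erg x N) + LinesearchPDHG.dgap K hs xs ys (erg y N) :=
    (LinesearchPDHG.pgap_add_dgap K g hs xs ys _ _).symm
  have esum : ∑ n ∈ Finset.range N, ((N : ℝ)⁻¹ • LinesearchPDHG.pgap K g xs ys (x (n + 1)))
      + ∑ n ∈ Finset.range N, ((N : ℝ)⁻¹ • LinesearchPDHG.dgap K hs xs ys (y (n + 1))) =
      (N : ℝ)⁻¹ * ∑ n ∈ Finset.range N, (lagr K g hs (x (n + 1)) ys - lagr K g hs xs (y (n + 1))) := by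
    rw [Finset.mul_sum, ← Finset.sum_add_distrib]
    refine Finset.sum_congr rfl fun n _ => ?_
    rw [smul_eq_mul, smul_eq_mul, ← mul_add, LinesearchPDHG.pgap_add_dgap]
  have hfin : (N : ℝ)⁻¹ * ∑ n ∈ Finset.range N, (lagr K g hs (x (n + 1)) ys - lagr K g hs xs (y (n + 1)))
      ≤ (‖xs - x 0‖ + Real.sqrt (τ / σ) * ‖ys - y 0‖ + 2 * errA τ e ρ N
        + Real.sqrt (2 * errB τ ε δ N)) ^ 2 / (2 * τ * N) := by
    have h1 := mul_le_mul_of_nonneg_left hsum (inv_nonneg.2 hNr.le)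
    refine h1.trans (le_of_eq ?_)
    field_simp
  linarith [egap, esum, hP, hD, hfin]

/-- **Corollary 3.4 (the `α > 1/2` case, qualitatively)**: if the error sums stay bounded,
`A_N ≤ A`, `B_N ≤ B` for all `N` (summable `‖e^n‖`, `ρ_n`, `ε_n`, `δ_n`), the ergodic gap decays
like `O(1/N)`: `L(X^N, ŷ) − L(x̂, Y^N) ≤ (‖x̂ − x^0‖ + √(τ/σ)‖ŷ − y^0‖ + 2A + √(2B))²/(2τN)`.
[cite: RaschChambolle2020, Cor 3.4 (α > 1/2)] -/
theorem ergodic_gap_le_of_bounded (h : IsInexactPDHGRun K g hs C D τ σ x y e ρ ε δ) (hτ : 0 < τ)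
    (hσ : 0 < σ) (hK : τ * σ * ‖K‖ ^ 2 ≤ 1) (hg : ConvexOn ℝ C g) (hhs : ConvexOn ℝ D hs)
    (hsad : IsSaddleOn K g hs C D xs ys) (hε : ∀ n, 0 ≤ ε n) (hδ : ∀ n, 0 ≤ δ n)
    (hρ : ∀ n, 0 ≤ ρ n) {A B : ℝ} (hA : ∀ N, errA τ e ρ N ≤ A) (hB : ∀ N, errB τ ε δ N ≤ B)
    {N : ℕ} (hN : 0 < N) :
    lagr K g hs (erg x N) ys - lagr K g hs xs (erg y N) ≤
      (‖xs - x 0‖ + Real.sqrt (τ / σ) * ‖ys - y 0‖ + 2 * A + Real.sqrt (2 * B)) ^ 2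
        / (2 * τ * N) := by
  refine (h.ergodic_gap_le hτ hσ hK hg hhs hsad hε hδ hρ hN).trans ?_
  have hNr : (0 : ℝ) < N := by exact_mod_cast hN
  have hA0 := errA_nonneg hτ.le hρ N (e := e)
  have hB0 := errB_nonneg hτ.le hε hδ N
  refine div_le_div_of_nonneg_right (pow_le_pow_left₀ (by positivity) ?_ 2) (by positivity)
  have := Real.sqrt_le_sqrt (mul_le_mul_of_nonneg_left (hB N) two_pos.le)
  linarith [hA N]

/-! ### The conic kernel: `g = ⟪c,·⟫ + ι_C`, `h* = ⟪b,·⟫ + ι_D` (inexact projections) -/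

omit [CompleteSpace X] [CompleteSpace Y] in
/-- A linear functional is convex on any convex set. [cite: RaschChambolle2020, §3 (standing assumptions: g, h convex)] -/
theorem convexOn_inner_const {C : Set X} (hC : Convex ℝ C) (c : X) :
    ConvexOn ℝ C (fun x : X => ⟪c, x⟫) := by
  have h := ((innerSL ℝ c : X →L[ℝ] ℝ) : X →ₗ[ℝ] ℝ).convexOn hC
  refine ⟨hC, fun u hu v hv a b ha hb hab => ?_⟩
  have := h.2 hu hv ha hb hab
  simpa using this

/-- **Theorem 3.2 for the conic kernel of PDLP-type solvers**: with `g = ⟪c, ·⟫ + ι_C`,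
`h* = ⟪b, ·⟫ + ι_D` (`C`, `D` convex — boxes, affine pins, cones), the proximal maps are the
projections `P_C(· − τc)`, `P_D(· − σb)` and the saddle function is
`conicL K c b x y = ⟪c, x⟫ + ⟪Kx, y⟫ − ⟪b, y⟫` of `PrimalDualHybridGradient.lean`. If the dual
projections are computed as type-2 approximations with precisions `δ_n` (for a cone `D`:
`isType2ProxPt_linear_cone_iff` — membership, polar membership of the residual, complementarity gap
`≤ σδ_n`) and the primal ones in the common type-1/2/3 form with `(ρ_n, ε_n)` and linear-part
errors `e^n`, then for `τσ‖K‖² ≤ 1`, a saddle point `(x̂, ŷ)` on `C × D` and `N ≥ 1`: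
`conicL(X^N, ŷ) − conicL(x̂, Y^N) ≤ (‖x̂ − x^0‖ + √(τ/σ)‖ŷ − y^0‖ + 2A_N + √(2B_N))²/(2τN)` — the
exact-projection bound of [CP16, Thm 1] (`PrimalDualHybridGradient.conicL_gap_ergodic_le`) with
the error sums inside the square. [cite: RaschChambolle2020, Thm 3.2 (applied to (3.1) with f = 0, g and h* linear plus indicators)] -/
theorem ergodic_conicL_gap_le {C : Set X} {D : Set Y} (hC : Convex ℝ C) (hD : Convex ℝ D)
    {c : X} {b : Y}
    (h : IsInexactPDHGRun K (fun x : X => ⟪c, x⟫) (fun y : Y => ⟪b, y⟫) C D τ σ x y e ρ ε δ)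
    (hτ : 0 < τ) (hσ : 0 < σ) (hK : τ * σ * ‖K‖ ^ 2 ≤ 1)
    (hsad : IsSaddleOn K (fun x : X => ⟪c, x⟫) (fun y : Y => ⟪b, y⟫) C D xs ys)
    (hε : ∀ n, 0 ≤ ε n) (hδ : ∀ n, 0 ≤ δ n) (hρ : ∀ n, 0 ≤ ρ n) {N : ℕ} (hN : 0 < N) :
    PrimalDualHybridGradient.conicL K c b (erg x N) ys
        - PrimalDualHybridGradient.conicL K c b xs (erg y N) ≤
      (‖xs - x 0‖ + Real.sqrt (τ / σ) * ‖ys - y 0‖ + 2 * errA τ e ρ N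
        + Real.sqrt (2 * errB τ ε δ N)) ^ 2 / (2 * τ * N) := by
  have h1 := h.ergodic_gap_le hτ hσ hK (convexOn_inner_const hC c) (convexOn_inner_const hD b)
    hsad hε hδ hρ hN
  simpa only [LinesearchPDHG.lagr_eq_conicL] using h1

end IsInexactPDHGRun

end Algorithm

end InexactPDHG

end Literature.Analysis.Convex
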